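import Literature.Probability.Percolation.FKLoopNestingMeasureUnique
import Literature.Probability.Percolation.LocalLimitMeasure
import HarnessLib

/-!
# The measure in DKLM Corollary 10 exists: the free random-cluster limit on `ℤ²` for `q ≥ 1`

Companion of `Literature.Probability.Percolation.FKLoopNestingGaussianLimit` (the named fact
`dklm2026_corollary10`, Duminil-Copin–Kozlowski–Lammers–Manolescu, arXiv:2603.06268, Cor. 10)
and of `FKLoopNestingMeasureUnique` (uniqueness of the measure in its hypothesis). Here we PROVE
the free half of Grimmett's thermodynamic-limit theorem on `ℤ²`:

> **Theorem (4.19)(a)** (Grimmett 2006). Let `p ∈ [0,1]`, `q ≥ 1`. The weak limit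
> `φ⁰_{p,q} = lim_{Λ ↑ ℤ^d} φ⁰_{Λ,p,q}` exists.

in the tree's vocabulary: for `p ∈ [0,1]` and `q ≥ 1` there is a (unique) probability measure `P`
on the bond configurations of `ℤ²` with `IsFreeRandomClusterLimit p q P`
(`exists_isFreeRandomClusterLimit`, `existsUnique_isFreeRandomClusterLimit`). In particular the
hypothesis of `dklm2026_corollary10` is inhabited at EVERY `q ∈ [1,4]`
(`existsUnique_isFreeRandomClusterLimit_rcSelfDualPoint`), not only at `q = 1`
(`isFreeRandomClusterLimit_bondPercolation_half`), so the fact has content on its whole range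
and its `∀ P` reading is literally the printed statement about `φ_{ℤ²,q}`.

## Proof (Grimmett 2006, proof of Thm. (4.19)(a), assembled from the tree)

* **Increasing cylinders** (`tendsto_rcFreeBoxMeasure_pieceCylinderEvent_of_subset`): for a
  finite set `E₀` of pairs, `n ↦ φ⁰_{Λ_n,p,q}(all pairs of E₀ open)` is non-decreasing once
  `Λ_n ⊇ E₀` — the tree's monotonicity of the free measures in the domain, Grimmett's (4.24)
  (`LatticeModels.rcMeasure_real_box_free_le_restrict`, from the free domain Markov property and
  the FKG inequality) — and bounded by `1`, hence convergent.
* **All cylinders** (`tendsto_measureReal_cylinderEvent_of_subset`): by induction on the number of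
  pairs prescribed CLOSED, splitting on the state of one of them
  (`cylinderEvent_erase_eq_union`: `C(E₀ ∖ {e₀}, S) = C(E₀, S) ⊔ C(E₀, S ∪ {e₀})`), inclusion–
  exclusion one edge at a time.
* **All local events** (`tendsto_measureReal_of_isLocalEvent`): an event determined by the finite
  set `F` is the disjoint union of the cylinders `C(F, S)`, `S ⊆ F`, it contains.
* **The limit measure**: the free box measures, pushed forward to configurations of `ℤ²` (edges
  off the box closed), converge on every local event, so the tree's Kolmogorov-extension
  packaging `exists_measure_tendsto_of_isLocalEvent` (`LocalLimitMeasure.lean`) produces a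
  probability measure with the limiting cylinder probabilities.

Everything is proved; no named fact is introduced; `d = 2` only because `IsFreeRandomClusterLimit`
is stated on `ℤ²`.

## References

* G. Grimmett, *The Random-Cluster Model*, Springer 2006: §4.1 (cylinder σ-field), §4.2
  (4.11)–(4.12) (free box measures), Lemma (4.13), Thm. (4.19)(a) and its proof, eq. (4.24).
  [Grimmett2006]
* H. Duminil-Copin, K. K. Kozlowski, P. Lammers, I. Manolescu, arXiv:2603.06268 (2026), Cor. 10.
  [DuminilCopinKozlowskiLammersManolescu2026]
-/

noncomputable section

open MeasureTheory Set Filter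
open scoped Topology ENNReal

namespace Literature.Probability.Percolation

open LatticeModels

/-! ### Cylinder events are local; splitting a cylinder on one pair -/

/-- A cylinder event is a local event (determined by the prescribed pairs `E₀`). [cite: Grimmett2006, §4.1] -/
theorem isLocalEvent_cylinderEvent (E₀ S : Finset (Sym2 (Site 2))) :
    IsLocalEvent (cylinderEvent E₀ S) := by
  refine ⟨E₀, (determinedBy_iff _ _).2 fun ω ω' h => ?_⟩
  simp only [mem_cylinderEvent_iff]
  refine forall₂_congr fun e he => ?_
  have h1 := Set.ext_iff.1 h e
  simp only [Set.mem_inter_iff, Finset.mem_coe] at h1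
  have : e ∈ ω ↔ e ∈ ω' := ⟨fun he' => (h1.1 ⟨he', he⟩).1, fun he' => (h1.2 ⟨he', he⟩).1⟩
  rw [this]

/-- Splitting a cylinder event on the state of one further pair `e₀ ∉ S`:
`C(E₀ ∖ {e₀}, S) = C(E₀, S) ∪ C(E₀, S ∪ {e₀})`. [folklore] -/
theorem cylinderEvent_erase_eq_union [DecidableEq (Sym2 (Site 2))] {E₀ S : Finset (Sym2 (Site 2))}
    {e₀ : Sym2 (Site 2)} (he₀S : e₀ ∉ S) :
    cylinderEvent (E₀.erase e₀) S = cylinderEvent E₀ S ∪ cylinderEvent E₀ (insert e₀ S) := by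
  ext ω
  simp only [Set.mem_union, mem_cylinderEvent_iff, Finset.mem_erase, Finset.mem_insert]
  constructor
  · intro h
    by_cases hω : e₀ ∈ ω
    · refine Or.inr fun e he => ?_
      by_cases hee : e = e₀
      · subst hee
        exact ⟨fun _ => Or.inl rfl, fun _ => hω⟩
      · rw [h e ⟨hee, he⟩]
        exact ⟨fun hs => Or.inr hs, fun h' => h'.resolve_left hee⟩
    · refine Or.inl fun e he => ?_
      by_cases hee : e = e₀
      · subst hee
        exact ⟨fun h' => absurd h' hω, fun h' => absurd h' he₀S⟩
      · exact h e ⟨hee, he⟩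
  · rintro (h | h) e ⟨hne, he⟩
    · exact h e he
    · rw [h e he]
      exact ⟨fun h' => h'.resolve_left hne, fun hs => Or.inr hs⟩

/-- The two pieces of the splitting are disjoint. [folklore] -/
theorem disjoint_cylinderEvent_insert {E₀ S : Finset (Sym2 (Site 2))} {e₀ : Sym2 (Site 2)}
    [DecidableEq (Sym2 (Site 2))] (he₀ : e₀ ∈ E₀) (he₀S : e₀ ∉ S) :
    Disjoint (cylinderEvent E₀ S) (cylinderEvent E₀ (insert e₀ S)) := by
  rw [Set.disjoint_left]
  intro ω h h'
  rw [mem_cylinderEvent_iff] at h h'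
  exact he₀S ((h e₀ he₀).1 ((h' e₀ he₀).2 (Finset.mem_insert_self e₀ S)))

/-- Cylinder events over the same pairs with different prescriptions are disjoint. [folklore] -/
theorem disjoint_cylinderEvent_of_ne {F S S' : Finset (Sym2 (Site 2))} (hS : S ⊆ F) (hS' : S' ⊆ F)
    (hne : S ≠ S') : Disjoint (cylinderEvent F S) (cylinderEvent F S') := by
  rw [Set.disjoint_left]
  intro ω h h'
  rw [mem_cylinderEvent_iff] at h h'
  apply hne
  ext e
  exact ⟨fun he => (h' e (hS he)).1 ((h e (hS he)).2 he),
    fun he => (h e (hS' he)).1 ((h' e (hS' he)).2 he)⟩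

/-! ### From increasing cylinders to all cylinders to all local events -/

/-- **Inclusion–exclusion, one pair at a time.** If, for a sequence of finite measures on the bond
configurations of `ℤ²`, the probabilities of the INCREASING cylinder events `C(E₀, S)`, `E₀ ⊆ S`
("all pairs of `E₀` open") converge, then the probabilities of all cylinder events converge.
[cite: Grimmett2006, Thm. (4.19)(a), proof] -/
theorem tendsto_measureReal_cylinderEvent_of_subset (νs : ℕ → Measure (BondConfig (Site 2)))
    [∀ n, IsFiniteMeasure (νs n)]
    (h : ∀ E₀ S : Finset (Sym2 (Site 2)), E₀ ⊆ S →
      ∃ r : ℝ, Tendsto (fun n => (νs n).real (cylinderEvent E₀ S)) atTop (𝓝 r))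
    (E₀ S : Finset (Sym2 (Site 2))) :
    ∃ r : ℝ, Tendsto (fun n => (νs n).real (cylinderEvent E₀ S)) atTop (𝓝 r) := by
  classical
  -- induction on the number `|E₀ ∖ S|` of pairs prescribed closed
  suffices H : ∀ k : ℕ, ∀ E₀ S : Finset (Sym2 (Site 2)), (E₀ \ S).card = k →
      ∃ r : ℝ, Tendsto (fun n => (νs n).real (cylinderEvent E₀ S)) atTop (𝓝 r) from
    H _ E₀ S rfl
  intro k
  induction k with
  | zero =>
    intro E₀ S hk
    rw [Finset.card_eq_zero, Finset.sdiff_eq_empty_iff_subset] at hk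
    exact h E₀ S hk
  | succ k ih =>
    intro E₀ S hk
    obtain ⟨e₀, he₀⟩ : (E₀ \ S).Nonempty := by
      rw [← Finset.card_pos, hk]
      exact Nat.succ_pos k
    rw [Finset.mem_sdiff] at he₀
    obtain ⟨he₀E, he₀S⟩ := he₀
    have hk1 : (E₀.erase e₀ \ S).card = k := by
      rw [Finset.erase_sdiff_comm, Finset.card_erase_of_mem (Finset.mem_sdiff.2 ⟨he₀E, he₀S⟩), hk]
      rfl
    have hk2 : (E₀ \ insert e₀ S).card = k := by
      rw [Finset.sdiff_insert, Finset.card_erase_of_mem (Finset.mem_sdiff.2 ⟨he₀E, he₀S⟩), hk]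
      rfl
    obtain ⟨r₁, hr₁⟩ := ih (E₀.erase e₀) S hk1
    obtain ⟨r₂, hr₂⟩ := ih E₀ (insert e₀ S) hk2
    refine ⟨r₁ - r₂, ?_⟩
    have heq : ∀ n, (νs n).real (cylinderEvent E₀ S) =
        (νs n).real (cylinderEvent (E₀.erase e₀) S) -
          (νs n).real (cylinderEvent E₀ (insert e₀ S)) := by
      intro n
      rw [cylinderEvent_erase_eq_union he₀S,
        measureReal_union (disjoint_cylinderEvent_insert he₀E he₀S)
          (measurableSet_cylinderEvent _ _)]
      ring
    simp_rw [heq]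
    exact hr₁.sub hr₂

/-- **From cylinders to local events.** If the cylinder probabilities of a sequence of finite
measures converge, so do the probabilities of every local event: an event determined by the
finite set `F` of pairs is the disjoint union of the cylinder events `C(F, S)`, `S ⊆ F`, that it
contains. [cite: Grimmett2006, §4.1] -/
theorem tendsto_measureReal_of_isLocalEvent (νs : ℕ → Measure (BondConfig (Site 2)))
    [∀ n, IsFiniteMeasure (νs n)]
    (h : ∀ E₀ S : Finset (Sym2 (Site 2)),
      ∃ r : ℝ, Tendsto (fun n => (νs n).real (cylinderEvent E₀ S)) atTop (𝓝 r))
    {A : Set (BondConfig (Site 2))} (hA : IsLocalEvent A) :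
    ∃ r : ℝ, Tendsto (fun n => (νs n).real A) atTop (𝓝 r) := by
  classical
  obtain ⟨F, hF⟩ := hA
  rw [determinedBy_iff] at hF
  set T : Finset (Finset (Sym2 (Site 2))) :=
    F.powerset.filter fun S => ((S : Set (Sym2 (Site 2))) ∈ A) with hT
  -- decomposition of `A` into the cylinders it contains
  have hdec : A = ⋃ S ∈ T, cylinderEvent F S := by
    ext ω
    simp only [Set.mem_iUnion, hT, Finset.mem_filter, Finset.mem_powerset, exists_prop]
    constructor
    · intro hω
      refine ⟨F.filter (· ∈ ω), ⟨Finset.filter_subset _ _, ?_⟩, ?_⟩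
      · refine (hF ω _ ?_).1 hω
        ext e
        simp only [Set.mem_inter_iff, Finset.mem_coe, Finset.coe_filter, Set.mem_setOf_eq]
        tauto
      · rw [mem_cylinderEvent_iff]
        intro e he
        simp only [Finset.mem_filter]
        tauto
    · rintro ⟨S, ⟨-, hSA⟩, hω⟩
      rw [mem_cylinderEvent_iff] at hω
      refine (hF ω S ?_).2 hSA
      ext e
      simp only [Set.mem_inter_iff, Finset.mem_coe]
      exact ⟨fun h' => ⟨(hω e h'.2).1 h'.1, h'.2⟩, fun h' => ⟨(hω e h'.2).2 h'.1, h'.2⟩⟩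
  have hdisj : (T : Set (Finset (Sym2 (Site 2)))).PairwiseDisjoint fun S => cylinderEvent F S := by
    intro S hS S' hS' hne
    have hSF : S ⊆ F := Finset.mem_powerset.1 (Finset.mem_filter.1 hS).1
    have hS'F : S' ⊆ F := Finset.mem_powerset.1 (Finset.mem_filter.1 hS').1
    exact disjoint_cylinderEvent_of_ne hSF hS'F hne
  have hsum : ∀ n, (νs n).real A = ∑ S ∈ T, (νs n).real (cylinderEvent F S) := by
    intro n
    rw [hdec]
    exact measureReal_biUnion_finset hdisj fun S _ => measurableSet_cylinderEvent F S
  choose r hr using h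
  refine ⟨∑ S ∈ T, r F S, ?_⟩
  simp_rw [hsum]
  exact tendsto_finsetSum _ fun S _ => hr F S

/-! ### The increasing cylinders of the free box measures converge (Grimmett's (4.24)) -/

/-- With every prescribed pair open, the projected cylinder event is the intersection of the
"edge open" events `eOpen`. [folklore] -/
theorem pieceCylinderEvent_eq_iInter_eOpen (Λ : Finset (Site 2)) {E₀ S : Finset (Sym2 (Site 2))}
    (hES : E₀ ⊆ S) : pieceCylinderEvent Λ E₀ S = ⋂ e ∈ E₀, eOpen Λ e := by
  ext ω
  simp only [mem_pieceCylinderEvent_iff, Set.mem_iInter, mem_eOpen_iff]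
  exact forall₂_congr fun e he => iff_true_right (hES he)

/-- With every prescribed pair open, the projected cylinder event is increasing. [folklore] -/
theorem isUpperSet_pieceCylinderEvent_of_subset (Λ : Finset (Site 2))
    {E₀ S : Finset (Sym2 (Site 2))} (hES : E₀ ⊆ S) : IsUpperSet (pieceCylinderEvent Λ E₀ S) := by
  rw [pieceCylinderEvent_eq_iInter_eOpen Λ hES]
  exact isUpperSet_iInter₂ fun e _ => isUpperSet_eOpen Λ e

/-- **Monotonicity in the box** (Grimmett 2006, (4.24)): for `p ∈ [0,1]`, `q ≥ 1` and boxes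
`Λ_m ⊆ Λ_n` both containing the pairs of `E₀`,
`φ⁰_{Λ_m,p,q}(E₀ open) ≤ φ⁰_{Λ_n,p,q}(E₀ open)`. [cite: Grimmett2006, Thm. (4.19)(a), proof, eq. (4.24)] -/
theorem rcFreeBoxMeasure_real_pieceCylinderEvent_mono {p q : ℝ} (hp : p ∈ Set.Icc (0 : ℝ) 1)
    (hq : 1 ≤ q) {E₀ S : Finset (Sym2 (Site 2))} (hES : E₀ ⊆ S) {m n : ℕ}
    (hm : E₀.sup pairRad ≤ m) (hmn : m ≤ n) :
    (rcFreeBoxMeasure p q m).real (pieceCylinderEvent (box 2 m) E₀ S) ≤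
      (rcFreeBoxMeasure p q n).real (pieceCylinderEvent (box 2 n) E₀ S) := by
  have hpre : finsetRestrict (box_mono 2 hmn) ⁻¹' pieceCylinderEvent (box 2 m) E₀ S =
      pieceCylinderEvent (box 2 n) E₀ S := by
    rw [pieceCylinderEvent_eq_iInter_eOpen _ hES, pieceCylinderEvent_eq_iInter_eOpen _ hES,
      Set.preimage_iInter₂]
    refine Set.iInter₂_congr fun e he => ?_
    exact finsetRestrict_preimage_eOpen _ (forall_mem_box_of_sup_le hm he)
  have h := rcMeasure_real_box_free_le_restrict hmn hp hq
    (isUpperSet_pieceCylinderEvent_of_subset (box 2 m) hES)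
  rw [hpre] at h
  exact h

/-- **The increasing cylinder probabilities of the free box measures converge** (monotone and
bounded). [cite: Grimmett2006, Thm. (4.19)(a), proof] -/
theorem tendsto_rcFreeBoxMeasure_pieceCylinderEvent_of_subset {p q : ℝ}
    (hp : p ∈ Set.Icc (0 : ℝ) 1) (hq : 1 ≤ q) {E₀ S : Finset (Sym2 (Site 2))} (hES : E₀ ⊆ S) :
    ∃ r : ℝ, Tendsto (fun n => (rcFreeBoxMeasure p q n).real (pieceCylinderEvent (box 2 n) E₀ S))
      atTop (𝓝 r) := by
  have hq0 : 0 < q := by linarith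
  obtain ⟨n₀, hn₀⟩ : ∃ n₀, E₀.sup pairRad ≤ n₀ := ⟨_, le_rfl⟩
  have hmono : Monotone fun k : ℕ =>
      (rcFreeBoxMeasure p q (k + n₀)).real (pieceCylinderEvent (box 2 (k + n₀)) E₀ S) := by
    refine monotone_nat_of_le_succ fun k => ?_
    exact rcFreeBoxMeasure_real_pieceCylinderEvent_mono hp hq hES
      (hn₀.trans (Nat.le_add_left n₀ k)) (by omega)
  have hbdd : BddAbove (Set.range fun k : ℕ =>
      (rcFreeBoxMeasure p q (k + n₀)).real (pieceCylinderEvent (box 2 (k + n₀)) E₀ S)) := by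
    refine ⟨1, ?_⟩
    rintro _ ⟨k, rfl⟩
    haveI := isProbabilityMeasure_rcFreeBoxMeasure hp hq0 (k + n₀)
    exact measureReal_le_one
  exact ⟨_, (Filter.tendsto_add_atTop_iff_nat n₀).1 (tendsto_atTop_ciSup hmono hbdd)⟩

/-! ### Existence of the free infinite-volume random-cluster measure on `ℤ²` -/

/-- **Grimmett 2006, Thm. (4.19)(a), free boundary conditions, on `ℤ²`**: for `p ∈ [0,1]` and
`q ≥ 1` the free box measures `φ⁰_{Λ_n,p,q}` converge weakly, i.e. there is a probability measure
`P` on the bond configurations of `ℤ²` whose cylinder probabilities are the limits of theirs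
(`IsFreeRandomClusterLimit p q P`). [cite: Grimmett2006, Thm. (4.19)(a)] -/
theorem exists_isFreeRandomClusterLimit {p q : ℝ} (hp : p ∈ Set.Icc (0 : ℝ) 1) (hq : 1 ≤ q) :
    ∃ P : Measure (BondConfig (Site 2)), IsFreeRandomClusterLimit p q P := by
  classical
  have hq0 : 0 < q := by linarith
  haveI hprob : ∀ n, IsProbabilityMeasure (rcFreeBoxMeasure p q n) := fun n =>
    isProbabilityMeasure_rcFreeBoxMeasure hp hq0 n
  -- the box configurations pushed forward to configurations of `ℤ²` (edges off the box closed)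
  have hmeas : ∀ n : ℕ,
      Measurable fun ω : BondConfig ↥(box 2 n) => (Sym2.map Subtype.val '' ω : BondConfig (Site 2)) :=
    fun n => measurable_of_finite _
  let μs : ℕ → Measure (BondConfig (Site 2)) := fun n =>
    (rcFreeBoxMeasure p q n).map fun ω => (Sym2.map Subtype.val '' ω : BondConfig (Site 2))
  haveI hμprob : ∀ n, IsProbabilityMeasure (μs n) := fun n =>
    Measure.isProbabilityMeasure_map (hmeas n).aemeasurable
  have hpre : ∀ (n : ℕ) (E₀ S : Finset (Sym2 (Site 2))),
      (fun ω : BondConfig ↥(box 2 n) => (Sym2.map Subtype.val '' ω : BondConfig (Site 2))) ⁻¹'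
          cylinderEvent E₀ S = pieceCylinderEvent (box 2 n) E₀ S := by
    intro n E₀ S
    ext ω
    simp only [Set.mem_preimage, mem_cylinderEvent_iff, mem_pieceCylinderEvent_iff, Set.mem_image]
  have hcyl : ∀ (n : ℕ) (E₀ S : Finset (Sym2 (Site 2))), (μs n).real (cylinderEvent E₀ S) =
      (rcFreeBoxMeasure p q n).real (pieceCylinderEvent (box 2 n) E₀ S) := by
    intro n E₀ S
    simp only [μs, measureReal_def]
    rw [Measure.map_apply (hmeas n) (measurableSet_cylinderEvent E₀ S), hpre]
  -- convergence: increasing cylinders, all cylinders, all local events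
  have h1 : ∀ E₀ S : Finset (Sym2 (Site 2)), E₀ ⊆ S →
      ∃ r : ℝ, Tendsto (fun n => (μs n).real (cylinderEvent E₀ S)) atTop (𝓝 r) := by
    intro E₀ S hES
    obtain ⟨r, hr⟩ := tendsto_rcFreeBoxMeasure_pieceCylinderEvent_of_subset hp hq hES
    exact ⟨r, hr.congr fun n => (hcyl n E₀ S).symm⟩
  have h2 := tendsto_measureReal_cylinderEvent_of_subset μs h1
  have h3 : ∀ A : Set (BondConfig (Site 2)), IsLocalEvent A →
      ∃ a : ℝ≥0∞, Tendsto (fun n => μs n A) atTop (𝓝 a) := by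
    intro A hA
    obtain ⟨r, hr⟩ := tendsto_measureReal_of_isLocalEvent μs h2 hA
    refine ⟨ENNReal.ofReal r, ?_⟩
    have : (fun n => μs n A) = fun n => ENNReal.ofReal ((μs n).real A) := by
      funext n
      rw [ofReal_measureReal]
    rw [this]
    exact ENNReal.tendsto_ofReal hr
  obtain ⟨P, hP, hlim⟩ := exists_measure_tendsto_of_isLocalEvent μs h3
  refine ⟨P, hP, fun E₀ S => ?_⟩
  have h4 : Tendsto (fun n => (μs n).real (cylinderEvent E₀ S)) atTop
      (𝓝 (P.real (cylinderEvent E₀ S))) :=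
    (ENNReal.tendsto_toReal (measure_ne_top P _)).comp (hlim _ (isLocalEvent_cylinderEvent E₀ S))
  exact h4.congr fun n => hcyl n E₀ S

/-- **Existence and uniqueness of the free random-cluster limit on `ℤ²`** for `p ∈ [0,1]`,
`q ≥ 1` (existence: Grimmett's Thm. (4.19)(a); uniqueness: the cylinder events generate,
`IsFreeRandomClusterLimit.unique`). [cite: Grimmett2006, Thm. (4.19)(a)] -/
theorem existsUnique_isFreeRandomClusterLimit {p q : ℝ} (hp : p ∈ Set.Icc (0 : ℝ) 1)
    (hq : 1 ≤ q) : ∃! P : Measure (BondConfig (Site 2)), IsFreeRandomClusterLimit p q P := by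
  obtain ⟨P, hP⟩ := exists_isFreeRandomClusterLimit hp hq
  exact ⟨P, hP, fun P' hP' => hP'.unique hP⟩

/-- **The hypothesis of `dklm2026_corollary10` is inhabited on its whole range**: for every
`q ∈ [1, 4]` there is exactly one free infinite-volume random-cluster limit at the self-dual
point `p_sd(q) = √q/(1+√q)` — the critical measure `φ_{ℤ²,q}` of DKLM's Corollary 10.
[cite: Grimmett2006, Thm. (4.19)(a) and (6.9)] -/
theorem existsUnique_isFreeRandomClusterLimit_rcSelfDualPoint {q : ℝ} (hq : q ∈ Set.Icc (1 : ℝ) 4) :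
    ∃! P : Measure (BondConfig (Site 2)), IsFreeRandomClusterLimit (rcSelfDualPoint q) q P :=
  existsUnique_isFreeRandomClusterLimit (rcSelfDualPoint_mem_Icc q) hq.1

end Literature.Probability.Percolation

end
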